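import Mathlib
import HarnessLib
import Literature.AlgebraicGeometry.Resolution.ResolutionOfSingularities
import Literature.AlgebraicGeometry.Resolution.RegularLocalRingsFlatDescent
import Summits.ResolutionOfSingularities.ResolutionOfSingularities.Theses.WildQuotients
import Summits.ResolutionOfSingularities.ResolutionOfSingularities.Theorems.WildQuotientsWildQuotientResolutionSliceInjective
import Summits.ResolutionOfSingularities.ResolutionOfSingularities.Theorems.WildQuotientsWildQuotientResolutionStubBirational

/-!
# True slices of `WildQuotientResolution` that are now unconditional (crux stmt-ResolutionOfSingularities-15640, line `Sketch`)

Support for the skeleton `Cruxes/WildQuotientResolution/Lines/Sketch.lean` of the crux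
`WildQuotients.WildQuotientResolution` (every Galois-type quotient `X₁` of a REGULAR integral `X′`
by a finite group, `q : X′ → X₁` finite surjective generically étale with fibres = orbits, has a
resolution). Two boundary slices of the crux, locating its content:

* **The flat / unramified boundary.** `isRegularLocalRing_stalk_of_flat_stalkMap`,
  `isRegular_of_flat_of_surjective`: regularity DESCENDS along a flat local homomorphism
  (Matsumura 23.7 (i), in tree as `IsRegularLocalRing.of_flat_ringHom`), so `X₁` is regular at
  every point over which `q` is flat, and a flat (e.g. étale) surjective `q` from a regular `X′`
  makes `X₁` regular — `hasResolution_of_flat_cover`, `hasResolution_of_etale_cover`: the slice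
  "`U = X₁`" of the crux is trivial, and the singularities of `X₁` lie under the NON-FLAT locus of
  `q` (for `X′` regular, hence Cohen–Macaulay, this is exactly the singular locus of the
  normalisation by miracle flatness — not formalised here).
* **The injective / trivial-group boundary, unconditionally.** Lemma (L)
  (`Birational.stub_birational_of_bijective`, p138276: finite étale and bijective over a
  positive-dimensional integral scheme of finite type over a field ⇒ birational) discharges the
  hypothesis `hL` of `SliceInjective.hasResolution_of_injective_of_L` /
  `SliceInjective.wq_of_subsingleton_of_L` (p136493): `hasResolution_of_injective`,
  `wq_of_subsingleton`. This closes the standing disprover's near-miss `slice_trivialGroup`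
  (`Cruxes/WildQuotientResolution/Disproof.lean` §E) outright: for `G = 1` the crux holds.

So the crux's content sits exactly in RAMIFIED actions with non-trivial stabilisers, as the
line card says; nothing here touches the two open stubs (`stub_phaseZero`, `stub_pClosedWQ`).
-/

-- single-problem summit: the doubled namespace component `ResolutionOfSingularities` is forced
set_option linter.dupNamespace false

noncomputable section

open CategoryTheory AlgebraicGeometry TopologicalSpace
open Literature.AlgebraicGeometry.Resolution

namespace Summit.ResolutionOfSingularities.ResolutionOfSingularities.Theorems.WildQuotientResolution.Slices

universe u

/-! ## The flat boundary: regularity descends along flat local homomorphisms -/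

/-- **Regularity descends pointwise along a flat stalk map** (Matsumura, Thm. 23.7 (i)): if
`q : X′ → X₁` has a flat stalk map at `x`, `X₁` is locally Noetherian and `𝒪_{X′,x}` is regular,
then `𝒪_{X₁, q x}` is regular. [cite: Matsumura1987, Thm. 23.7 (i)] -/
theorem isRegularLocalRing_stalk_of_flat_stalkMap {X' X₁ : Scheme.{u}} (q : X' ⟶ X₁)
    [IsLocallyNoetherian X₁] (x : X') (hflat : (q.stalkMap x).hom.Flat)
    (hx : IsRegularLocalRing (X'.presheaf.stalk x)) :
    IsRegularLocalRing (X₁.presheaf.stalk (q.base x)) :=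
  IsRegularLocalRing.of_flat_ringHom (q.stalkMap x).hom hflat

/-- **A flat surjective morphism from a regular scheme has regular (locally Noetherian) target.**
[cite: Matsumura1987, Thm. 23.7 (i)] -/
theorem isRegular_of_flat_of_surjective {X' X₁ : Scheme.{u}} (q : X' ⟶ X₁) [Flat q]
    [IsLocallyNoetherian X₁] (hreg : Scheme.IsRegular X') (hsurj : Function.Surjective q.base) :
    Scheme.IsRegular X₁ := fun y => by
  obtain ⟨x, rfl⟩ := hsurj y
  exact isRegularLocalRing_stalk_of_flat_stalkMap q x (Flat.stalkMap q x) (hreg x)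

/-- **The flat slice of the crux**: if the cover `q : X′ → X₁` of the crux is flat EVERYWHERE
(not only étale over a dense open), then `X₁` — locally of finite type over a field, hence locally
Noetherian — is regular and is its own resolution. [folklore] -/
theorem hasResolution_of_flat_cover {k : Type u} [Field k] {X' X₁ : Scheme.{u}}
    (f : X₁ ⟶ Spec (.of k)) [LocallyOfFiniteType f] (q : X' ⟶ X₁) [Flat q]
    (hreg : Scheme.IsRegular X') (hsurj : Function.Surjective q.base) :
    Scheme.HasResolution X₁ :=
  haveI : IsLocallyNoetherian X₁ := LocallyOfFiniteType.isLocallyNoetherian f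
  (isRegular_of_flat_of_surjective q hreg hsurj).hasResolution

/-- **The unramified slice of the crux** (`U = X₁`): an everywhere-étale surjective `q` from a
regular `X′` onto `X₁` locally of finite type over a field makes `X₁` regular, hence resolved by
the identity. [folklore] -/
theorem hasResolution_of_etale_cover {k : Type u} [Field k] {X' X₁ : Scheme.{u}}
    (f : X₁ ⟶ Spec (.of k)) [LocallyOfFiniteType f] (q : X' ⟶ X₁) [Etale q]
    (hreg : Scheme.IsRegular X') (hsurj : Function.Surjective q.base) :
    Scheme.HasResolution X₁ :=
  haveI : Flat q := (Etale.iff_flat_and_formallyUnramified.mp ‹_›).1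
  hasResolution_of_flat_cover f q hreg hsurj

/-! ## The injective boundary, unconditionally (lemma (L) is a theorem) -/

/-- **The injective slice of the crux, unconditional**: a finite surjective `q : X′ → X₁`,
INJECTIVE on points and étale over a dense open, from a regular integral `X′` onto an integral
`X₁` locally of finite type over a field, yields a resolution of `X₁` (`q` itself in positive
dimension, by lemma (L); the identity in dimension `0`). [folklore] -/
theorem hasResolution_of_injective (k : Type) [Field k] {X' X₁ : Scheme.{0}}
    (f : X₁ ⟶ Spec (.of k)) (q : X' ⟶ X₁) [LocallyOfFiniteType f] [IsIntegral X₁] [IsIntegral X']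
    (hreg : Scheme.IsRegular X') [IsFinite q] (hsurj : Function.Surjective q.base)
    (hinj : Function.Injective q.base) (hU : ∃ U : X₁.Opens, Dense (U : Set X₁) ∧ Etale (q ∣_ U)) :
    Scheme.HasResolution X₁ :=
  SliceInjective.hasResolution_of_injective_of_L
    (fun k _ _ _ f _ _ _ r hdim W hW _ _ hbij =>
      Birational.stub_birational_of_bijective k f r hdim W hW hbij)
    k f q hreg hsurj hinj hU

/-- **The crux for the trivial group, unconditional** (the disprover's near-miss
`slice_trivialGroup`, closed): with `G` a subsingleton, "fibres = orbits" makes `q` injective and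
`hasResolution_of_injective` applies. [folklore] -/
theorem wq_of_subsingleton (p : ℕ) (k : Type) [Field k] [CharP k p] (X' X₁ : Scheme.{0})
    (f : X₁ ⟶ Spec (.of k)) (q : X' ⟶ X₁) (G : Type) [Group G] [Subsingleton G]
    (ρ : G →* Aut X') [LocallyOfFiniteType f] [IsIntegral X₁] [IsIntegral X']
    (hreg : Scheme.IsRegular X') [IsFinite q] (hsurj : Function.Surjective q.base)
    (hU : ∃ U : X₁.Opens, Dense (U : Set X₁) ∧ Etale (q ∣_ U))
    (horb : ∀ x y : X', q.base x = q.base y → ∃ g : G, (ρ g).hom.base x = y) :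
    Scheme.HasResolution X₁ :=
  SliceInjective.wq_of_subsingleton_of_L
    (fun k _ _ _ f _ _ _ r hdim W hW _ _ hbij =>
      Birational.stub_birational_of_bijective k f r hdim W hW hbij)
    p k X' X₁ f q G ρ hreg hsurj hU horb

end Summit.ResolutionOfSingularities.ResolutionOfSingularities.Theorems.WildQuotientResolution.Slices

end
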